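import Summits.BirchSwinnertonDyer.BirchSwinnertonDyer.Theorems.AdditiveBranchIMCGordTwoRankZeroOffCaseOneTwistRowClosedKolyvagin
import Summits.BirchSwinnertonDyer.BirchSwinnertonDyer.Theorems.AdditiveBranchIMCGordTwoRankZeroOffCaseOneWanAnyRoadR0Stubs
import HarnessLib

/-!
# Route `AdditiveBranchIMC`, crux `GordTwoRankZeroOffCaseOne` (19357), line `three_field_road` — DOOR T (director (811), LeadReport29 §5):
# THE TWO `(E, K)`-KEYED FIELD-2 SUPPLIES WITHOUT THEIR TAMAGAWA IN- AND OUTPUT (LEAD g20; `--supports` 19357, helper only)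

Theorems only (no definition, no named fact, no `sorry`); nothing about BSD is asserted; the crux stays OPEN; BSD is proved for no curve.
The road's FIELD 2 supplies at an HONEST Wan prime — `ThreeFieldRoadSupply.exists_fieldTwo_gordTwo` (odd Wan prime `q`, sub-rows
`ThreeFieldRow` / `TwistRow`) and `WanAnyRoad.exists_fieldTwo_gordTwo_two` (Wan prime `2`, sub-row `DyadicWanRowR0`) — take `htam : p ∤ ∏ c_ℓ(E)`
ONLY to output `p ∤ ∏ c_ℓ(A)` (the last conjunct, consumed by `ThreeFieldRowClosed.jointUpperBoundAt_genus` alone; LeadReport29 §1). Door T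
replaces that consumer by the named research statement J (Tamagawa-free genus joint upper half, `…GenusTamagawaFreeUpper`), so the supplies are
re-proved here WITHOUT the Tamagawa binder and WITHOUT the Tamagawa conclusion — the landed proofs verbatim (over `exists_ramifiedClass_partner`
resp. `exists_ramifiedClass_partner_two`: Friedberg–Hoffstein Thm. B through Hoffstein–Luo, the `p`-ramified class `d_{K″} = p*·q*·ℓ₀*·d`
resp. `p*·e₂·ℓ₀*·d`, the partner `A ≅ E^{(u)}`, `u = p*Td`, good ordinary at `p`, `≅ E` over `ℚ_q`) with the `htamA` block deleted.
* `exists_fieldTwo_gordTwo_noTam` — odd Wan prime; * `exists_fieldTwo_gordTwo_two_noTam` — Wan prime `2`.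
References: [cite: FriedbergHoffstein1995, Thm. B (1)] [cite: HoffsteinLuo1997, Theorem (§1)] [cite: SilvermanAEC2009, X.5 Cor. 5.4, VII.5.1]
[cite: JetchevSkinnerWan2017, §7.4.1]. presearch: n/a (re-assembly of tree theorems).
-/

set_option autoImplicit false
set_option linter.dupNamespace false

noncomputable section

open scoped Classical

open WeierstrassCurve NumberField IsDedekindDomain Rat.HeightOneSpectrum
  Literature.NumberTheory.EllipticCurves Literature.NumberTheory.EllipticCurves.ModularForms
  Literature.NumberTheory.EllipticCurves.Rank1Residual Literature.NumberTheory.EllipticCurves.Rank1Residual.Typed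
  Summit.BirchSwinnertonDyer.Rank1Residual Summit.BirchSwinnertonDyer.Rank1Residual.Additive
  Summit.BirchSwinnertonDyer.BirchSwinnertonDyer.Theorems

namespace Summit.BirchSwinnertonDyer.BirchSwinnertonDyer.Theorems.GenusTamagawaFree

open NumberTheorySymbols ZMod ThreeFieldRoadSupply WanAnyRoad
open Summit.BirchSwinnertonDyer.BirchSwinnertonDyer.Theorems.AdditiveKoly.RamifiedHabitat (pStar_emod_four eq_of_prime_dvd_pStar)
open Literature.NumberTheory.EllipticCurves.Castella2018.TamagawaQuadratic

/-! ### §1 Odd Wan prime (`ThreeFieldRow` / `TwistRow`) -/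

/-- **FIELD 2 at an odd Wan prime, Tamagawa-free** — `ThreeFieldRoadSupply.exists_fieldTwo_gordTwo` without `htam` and without its last conjunct:
for `(E, p)` on the (G-ord, `e = 2`) cell with `p ≥ 5`, `w(E) = +1`, `ρ̄_{E,p}` onto, a Wan prime `q` (`q ∉ {2, p}`, non-split multiplicative,
`p ∤ v_q(Δ)`), the road field `K` and `Wd ≅ E^{(d_K)}`: a `p`-RAMIFIED Kolyvagin field `K''` for `(Wd, A)` (spelled out) with a free ramified prime,
and a globally minimal `A ≅ Wd^{(d_{K''})}` of analytic rank `0`, good ordinary at `p`, `ρ̄_{A,p}` onto, multiplicative at `q` with `p ∤ v_q(Δ_A)`.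
[cite: FriedbergHoffstein1995, Thm. B (1), as applied in JetchevSkinnerWan2017 §7.4.1] [cite: SilvermanAEC2009, X.5 Cor. 5.4, VII.5.1 and Thm VII.6.1] -/
theorem exists_fieldTwo_gordTwo_noTam
    (W : WeierstrassCurve ℚ) [W.IsElliptic] [W.IsGloballyMinimal] (p : ℕ) [hp : Fact p.Prime]
    {q : ℕ} [hq : Fact q.Prime] (K : Type) [Field K] [NumberField K]
    {Wd : WeierstrassCurve ℚ} [Wd.IsElliptic]
    (hFH : friedbergHoffstein_exists_heegnerField_splitDivisors_twist_ne_zero)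
    (hmod : exists_isNewformOf) (hL : hasEntireLFunction_rat)
    (hp5 : 5 ≤ p) (hw : W.rootNumber = 1) (hcell : N10.CellGordTwo W p) (hsurj : Surj W p)
    (hqp : q ≠ p) (hq2 : q ≠ 2) (hqm : W.HasMultiplicativeReductionAtPrime q)
    (hqns : ¬ W.HasSplitMultiplicativeReductionAtPrime q)
    (hqv : ¬ p ∣ padicValInt q W.minimalDiscriminantInt)
    (hK : IsImaginaryQuadratic K) (h2K : ((Ideal.span {(2 : ℤ)}).primesOver (𝓞 K)).ncard = 2)
    (hqd : (q : ℤ) ∣ NumberField.discr K)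
    (hsplit : ∀ ℓ : ℕ, ℓ.Prime → ℓ ∣ W.conductorNorm ℤ → ℓ ≠ q →
      ((Ideal.span {(ℓ : ℤ)}).primesOver (𝓞 K)).ncard = 2)
    (Cd : VariableChange ℚ) (hWd : Cd • W.quadraticTwist (NumberField.discr K : ℚ) = Wd) :
    ∃ (K'' : Type) (_ : Field K'') (_ : NumberField K'')
      (A : WeierstrassCurve ℚ) (_ : A.IsElliptic) (_ : A.IsGloballyMinimal),
      (IsImaginaryQuadratic K'' ∧ (p : ℤ) ∣ NumberField.discr K'' ∧
        (∀ ℓ : ℕ, ℓ.Prime → ℓ ∣ Wd.conductorNorm ℤ → ¬ (ℓ : ℤ) ∣ NumberField.discr K'' →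
          SatisfiesHeegnerHypothesis ℓ K'') ∧
        (∀ ℓ : ℕ, (hℓ : ℓ.Prime) → ℓ ∣ Wd.conductorNorm ℤ → (ℓ : ℤ) ∣ NumberField.discr K'' → ℓ ≠ p →
          (haveI : Fact ℓ.Prime := ⟨hℓ⟩;
            A.HasMultiplicativeReductionAtPrime ℓ ∧ ¬ A.HasSplitMultiplicativeReductionAtPrime ℓ))) ∧
      (∃ ℓ : ℕ, ℓ.Prime ∧ (ℓ : ℤ) ∣ NumberField.discr K'' ∧ ℓ ≠ p ∧ ¬ ℓ ∣ Wd.conductorNorm ℤ) ∧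
      (∃ C : VariableChange ℚ, C • Wd.quadraticTwist (NumberField.discr K'' : ℚ) = A) ∧
      A.analyticRank = 0 ∧ GoodOrd A p ∧ Surj A p ∧
      (∃ ℓ : ℕ, ∃ _ : Fact ℓ.Prime, ℓ ≠ p ∧ A.HasMultiplicativeReductionAtPrime ℓ ∧
        ¬ p ∣ padicValInt ℓ A.minimalDiscriminantInt) := by
  have hp2 : p ≠ 2 := by omega
  obtain ⟨ℓ₀, T, d, K'', iF'', iN'', A, iA, iAm, hℓ₀, hℓ₀p, hℓ₀q, hℓ₀NWd, hdisc, hK'', hsplit'', hram'',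
      hAWd, ⟨Cu, hCu⟩, hu4, husq, hJu, hrA, hgoA, hsurjA⟩ :=
    exists_ramifiedClass_partner W p K hFH hmod hL hp5 hw hcell hsurj hqp hq2 hK h2K hqd hsplit Cd hWd
  set u : ℤ := ((-1 : ℤ) ^ (p / 2) * p) * T * d with hu
  -- `u ≠ 0, 1`, `p ∣ u`
  have hpu : (p : ℤ) ∣ u := by
    rw [hu]
    refine Dvd.dvd.mul_right (Dvd.dvd.mul_right ?_ _) _
    exact Dvd.intro_left _ rfl
  have hu1 : u ≠ 1 := fun h ↦ by
    rw [h] at hpu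
    exact hp.out.ne_one (by exact_mod_cast Int.eq_one_of_dvd_one (by norm_num) hpu)
  have hu0 : u ≠ 0 := fun h ↦ by rw [h] at hu4; norm_num at hu4
  have huq : ((u : ℤ) : ℚ) ≠ 0 := by exact_mod_cast hu0
  -- squares at the bad primes `≠ p` of `E`
  have hsq : ∀ ℓ : ℕ, (hℓ : ℓ.Prime) → ℓ ∣ W.conductorNorm ℤ → ℓ ≠ p →
      (haveI : Fact ℓ.Prime := ⟨hℓ⟩; IsSquare (((u : ℤ) : ℚ) : ℚ_[ℓ])) := by
    intro ℓ hℓ hℓN hℓp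
    haveI : Fact ℓ.Prime := ⟨hℓ⟩
    exact isSquare_padic_of_fundamental hu4 husq hu1 (hJu ℓ hℓ hℓN hℓp)
  -- at the Wan prime `q`
  have hqN : q ∣ W.conductorNorm ℤ :=
    (W.dvd_conductorNorm_iff_not_hasGoodReductionAtPrime q).mpr
      (not_hasGoodReductionAtPrime_of_hasMultiplicativeReductionAtPrime q hqm)
  have hsqq : IsSquare (((u : ℤ) : ℚ) : ℚ_[q]) := hsq q hq.out hqN hqp
  have hmultA : A.HasMultiplicativeReductionAtPrime q :=
    (X11b.mult_iff_of_twist W huq hsqq A hCu).mpr hqm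
  have hnsA : ¬ A.HasSplitMultiplicativeReductionAtPrime q := by
    haveI := W.isElliptic_quadraticTwist huq
    rw [← hCu, hasSplitMultiplicativeReductionAtPrime_smul_iff,
      hasSplitMultiplicativeReductionAtPrime_quadraticTwist_iff W huq (by simpa using hsqq)]
    exact hqns
  have hΔq : padicValInt q A.minimalDiscriminantInt = padicValInt q W.minimalDiscriminantInt :=
    X11b.padicValInt_minimalDiscriminantInt_twist_eq W q huq (by simpa using hsqq) Cu hCu
  refine ⟨K'', iF'', iN'', A, iA, iAm, ⟨hK'', ?_, ?_, ?_⟩, ⟨ℓ₀, hℓ₀, ?_, hℓ₀p, hℓ₀NWd⟩, hAWd, hrA,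
    hgoA, hsurjA, ⟨q, hq, hqp, hmultA, by rw [hΔq]; exact hqv⟩⟩
  · -- `p ∣ d_{K''}`
    rw [hdisc]
    exact Dvd.dvd.mul_right (Dvd.dvd.mul_right (Dvd.dvd.mul_right (Dvd.intro_left _ rfl) _) _) _
  · -- every prime of `N_{Wd}` off `d_{K''}` splits in `K''`
    intro ℓ hℓ hℓN hℓD
    have hℓp : ℓ ≠ p := by
      rintro rfl
      apply hℓD
      rw [hdisc]
      exact Dvd.dvd.mul_right (Dvd.dvd.mul_right (Dvd.dvd.mul_right (Dvd.intro_left _ rfl) _) _) _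
    have hℓq : ℓ ≠ q := by
      rintro rfl
      apply hℓD
      rw [hdisc]
      exact Dvd.dvd.mul_right (Dvd.dvd.mul_right (Dvd.dvd.mul_left (Dvd.intro_left _ rfl) _) _) _
    exact hsplit'' ℓ hℓ (hℓN.mul_left _) hℓp hℓq
  · -- the common primes of `N_{Wd}` and `d_{K''}` other than `p`: only `q`, where `A` is non-split
    intro ℓ hℓ hℓN hℓD hℓp
    rcases hram'' ℓ hℓ hℓD (hℓN.mul_left _) with h | h
    · exact (hℓp h).elim
    · subst h
      exact ⟨hmultA, hnsA⟩
  · -- the free prime `ℓ₀ ∣ d_{K''}`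
    rw [hdisc]
    exact Dvd.dvd.mul_right (Dvd.dvd.mul_left (Dvd.intro_left _ rfl) _) _

/-! ### §2 Wan prime `2` (`DyadicWanRowR0`) -/

set_option maxHeartbeats 800000 in
/-- **FIELD 2 at the Wan prime `2`, Tamagawa-free** — `WanAnyRoad.exists_fieldTwo_gordTwo_two` without `htam` and without its last conjunct: a
`p`-RAMIFIED Kolyvagin field `K''` for `(Wd, A)` with `2` ramified and a free ramified prime, and a globally minimal `A ≅ Wd^{(d_{K''})}` of
analytic rank `0`, good ordinary at `p`, `ρ̄_{A,p}` onto, non-split multiplicative at `2` with `p ∤ v₂(Δ_A)`.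
[cite: FriedbergHoffstein1995, Thm. B (1), as applied in JetchevSkinnerWan2017 §7.4.1] [cite: SilvermanAEC2009, X.5 Cor. 5.4, VII.5.1 and Thm VII.6.1] -/
theorem exists_fieldTwo_gordTwo_two_noTam
    (W : WeierstrassCurve ℚ) [W.IsElliptic] [W.IsGloballyMinimal] (p : ℕ) [hp : Fact p.Prime]
    (K : Type) [Field K] [NumberField K] {Wd : WeierstrassCurve ℚ} [Wd.IsElliptic]
    (hFH : friedbergHoffstein_exists_heegnerField_splitDivisors_twist_ne_zero)
    (hmod : exists_isNewformOf) (hL : hasEntireLFunction_rat)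
    (hp5 : 5 ≤ p) (hw : W.rootNumber = 1) (hcell : N10.CellGordTwo W p) (hsurj : Surj W p)
    (h2p : 2 ≠ p) (h2m : W.HasMultiplicativeReductionAtPrime 2)
    (h2ns : ¬ W.HasSplitMultiplicativeReductionAtPrime 2)
    (h2v : ¬ p ∣ padicValInt 2 W.minimalDiscriminantInt)
    (hK : IsImaginaryQuadratic K) (h2d : (2 : ℤ) ∣ NumberField.discr K)
    (hsplit : ∀ ℓ : ℕ, ℓ.Prime → ℓ ∣ W.conductorNorm ℤ → ℓ ≠ 2 →
      ((Ideal.span {(ℓ : ℤ)}).primesOver (𝓞 K)).ncard = 2)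
    (Cd : VariableChange ℚ) (hWd : Cd • W.quadraticTwist (NumberField.discr K : ℚ) = Wd) :
    ∃ (K'' : Type) (_ : Field K'') (_ : NumberField K'')
      (A : WeierstrassCurve ℚ) (_ : A.IsElliptic) (_ : A.IsGloballyMinimal),
      (IsImaginaryQuadratic K'' ∧ (p : ℤ) ∣ NumberField.discr K'' ∧
        (∀ ℓ : ℕ, ℓ.Prime → ℓ ∣ Wd.conductorNorm ℤ → ¬ (ℓ : ℤ) ∣ NumberField.discr K'' →
          SatisfiesHeegnerHypothesis ℓ K'') ∧
        (∀ ℓ : ℕ, (hℓ : ℓ.Prime) → ℓ ∣ Wd.conductorNorm ℤ → (ℓ : ℤ) ∣ NumberField.discr K'' → ℓ ≠ p →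
          (haveI : Fact ℓ.Prime := ⟨hℓ⟩;
            A.HasMultiplicativeReductionAtPrime ℓ ∧ ¬ A.HasSplitMultiplicativeReductionAtPrime ℓ))) ∧
      (∃ ℓ : ℕ, ℓ.Prime ∧ (ℓ : ℤ) ∣ NumberField.discr K'' ∧ ℓ ≠ p ∧ ¬ ℓ ∣ Wd.conductorNorm ℤ) ∧
      (∃ C : VariableChange ℚ, C • Wd.quadraticTwist (NumberField.discr K'' : ℚ) = A) ∧
      A.analyticRank = 0 ∧ GoodOrd A p ∧ Surj A p ∧
      (∃ ℓ : ℕ, ∃ _ : Fact ℓ.Prime, ℓ ≠ p ∧ A.HasMultiplicativeReductionAtPrime ℓ ∧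
        ¬ p ∣ padicValInt ℓ A.minimalDiscriminantInt) := by
  have hp2 : p ≠ 2 := by omega
  obtain ⟨ℓ₀, e₂, T, d, K'', iF'', iN'', A, iA, iAm, hℓ₀, hℓ₀p, hℓ₀2, hℓ₀NWd, he₂, hdisc, hK'', hsplit'', hram'',
      hAWd, ⟨Cu, hCu⟩, hu4, husq, hJu, hrA, hgoA, hsurjA⟩ :=
    exists_ramifiedClass_partner_two W p K hFH hmod hL hp5 hw hcell hsurj hK h2d hsplit Cd hWd
  have he₂2 : (2 : ℤ) ∣ e₂ := by rcases he₂ with h | h | h <;> rw [h] <;> norm_num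
  set u : ℤ := ((-1 : ℤ) ^ (p / 2) * p) * T * d with hu
  -- `u ≠ 0, 1`, `p ∣ u`
  have hpu : (p : ℤ) ∣ u := by
    rw [hu]
    refine Dvd.dvd.mul_right (Dvd.dvd.mul_right ?_ _) _
    exact Dvd.intro_left _ rfl
  have hu1 : u ≠ 1 := fun h ↦ by
    rw [h] at hpu
    exact hp.out.ne_one (by exact_mod_cast Int.eq_one_of_dvd_one (by norm_num) hpu)
  have hu0 : u ≠ 0 := fun h ↦ by rw [h] at hu4; norm_num at hu4
  have huq : ((u : ℤ) : ℚ) ≠ 0 := by exact_mod_cast hu0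
  -- squares at the bad primes `≠ p` of `E`
  have hsq : ∀ ℓ : ℕ, (hℓ : ℓ.Prime) → ℓ ∣ W.conductorNorm ℤ → ℓ ≠ p →
      (haveI : Fact ℓ.Prime := ⟨hℓ⟩; IsSquare (((u : ℤ) : ℚ) : ℚ_[ℓ])) := by
    intro ℓ hℓ hℓN hℓp
    haveI : Fact ℓ.Prime := ⟨hℓ⟩
    exact isSquare_padic_of_fundamental hu4 husq hu1 (hJu ℓ hℓ hℓN hℓp)
  -- at the Wan prime `2`
  have hqN : 2 ∣ W.conductorNorm ℤ :=
    (W.dvd_conductorNorm_iff_not_hasGoodReductionAtPrime 2).mpr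
      (not_hasGoodReductionAtPrime_of_hasMultiplicativeReductionAtPrime 2 h2m)
  have hsqq : IsSquare (((u : ℤ) : ℚ) : ℚ_[2]) := hsq 2 Nat.prime_two hqN h2p
  have hmultA : A.HasMultiplicativeReductionAtPrime 2 :=
    (X11b.mult_iff_of_twist W huq hsqq A hCu).mpr h2m
  have hnsA : ¬ A.HasSplitMultiplicativeReductionAtPrime 2 := by
    haveI := W.isElliptic_quadraticTwist huq
    rw [← hCu, hasSplitMultiplicativeReductionAtPrime_smul_iff,
      hasSplitMultiplicativeReductionAtPrime_quadraticTwist_iff W huq (by simpa using hsqq)]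
    exact h2ns
  have hΔq : padicValInt 2 A.minimalDiscriminantInt = padicValInt 2 W.minimalDiscriminantInt :=
    X11b.padicValInt_minimalDiscriminantInt_twist_eq W 2 huq (by simpa using hsqq) Cu hCu
  refine ⟨K'', iF'', iN'', A, iA, iAm, ⟨hK'', ?_, ?_, ?_⟩, ⟨ℓ₀, hℓ₀, ?_, hℓ₀p, hℓ₀NWd⟩, hAWd, hrA,
    hgoA, hsurjA, ⟨2, inferInstance, h2p, hmultA, by rw [hΔq]; exact h2v⟩⟩
  · -- `p ∣ d_{K''}`
    rw [hdisc]
    exact Dvd.dvd.mul_right (Dvd.dvd.mul_right (Dvd.dvd.mul_right (Dvd.intro_left _ rfl) _) _) _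
  · -- every prime of `N_{Wd}` off `d_{K''}` splits in `K''`
    intro ℓ hℓ hℓN hℓD
    have hℓp : ℓ ≠ p := by
      rintro rfl
      apply hℓD
      rw [hdisc]
      exact Dvd.dvd.mul_right (Dvd.dvd.mul_right (Dvd.dvd.mul_right (Dvd.intro_left _ rfl) _) _) _
    have hℓq : ℓ ≠ 2 := by
      rintro rfl
      apply hℓD
      rw [hdisc]
      exact Dvd.dvd.mul_right (Dvd.dvd.mul_right (Dvd.dvd.mul_left he₂2 _) _) _
    exact hsplit'' ℓ hℓ (hℓN.mul_left _) hℓp hℓq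
  · -- the common primes of `N_{Wd}` and `d_{K''}` other than `p`: only `2`, where `A` is non-split
    intro ℓ hℓ hℓN hℓD hℓp
    rcases hram'' ℓ hℓ hℓD (hℓN.mul_left _) with h | h
    · exact (hℓp h).elim
    · subst h
      exact ⟨hmultA, hnsA⟩
  · -- the free prime `ℓ₀ ∣ d_{K''}`
    rw [hdisc]
    exact Dvd.dvd.mul_right (Dvd.dvd.mul_left (Dvd.intro_left _ rfl) _) _

end Summit.BirchSwinnertonDyer.BirchSwinnertonDyer.Theorems.GenusTamagawaFree

end
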